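import Mathlib
import Summits.ValiantsHypothesis.ValiantsHypothesis.Theorems.ValuativeGCTValuativeFlipHeadOfPencilCertificate
import Summits.ValiantsHypothesis.ValiantsHypothesis.Theorems.ValuativeGCTValuativeFlipCyclicTangentRankSharp

/-!
# The head of the window at every slope below `√2` (crux `ValuativeGCT.ValuativeFlip`, line `four-row-count`)

Wall-breaker axis P-explicit for crux `ValuativeGCT.ValuativeFlip` (stmt-ValiantsHypothesis-12624).  The
sub-crux `HeadFlip` (stmt-ValiantsHypothesis-15535) was closed at slope `6/5` (`HeadFlip_proof`, from the
cyclic tridiagonal certificate `cyc_pencilCertificate` with its `≈ 3n²` tangent-rank bound).  The strategist's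
census (`Cruxes/ValuativeFlip/STRATEGY-CENSUS.md`) records that the four-row count flips at every position
`m < √2·n - O(1)` PROVIDED the per-side pencil rank is the sharp `4n² - O(n)`; the sharp rank is now a theorem
(`cyc_finrank_tanV_ge_sharp`, `cyc_pencilCertificate_of_sq_lt`), so the line reaches its natural limit:

* `headFlipBody_of_sq_lt_two` — for every `0 < b` and `a² < 2b²` (i.e. every rational slope `a/b < √2`),
  for all large `n` and EVERY `n ≤ m` with `b·m ≤ a·n`, the body of the route decl `ValuativeGCT.ValuativeFlip`
  holds at `(n, m)` (verbatim `let χ`, `let T`; witnesses `U = ⊥`, `r = 0`, a shape with at most four rows):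
  symmetric-Kronecker-type multiplicity obstructions `dim T_⊥(λ) < mult_{λ*} ℂ[Δ_m(X₀₀^{m-n} per_n)]`
  at every window position of the linear head up to slope `√2`;
* `headFlipBody_seven_fifths` — the instance `a/b = 7/5` (`49 < 50`);
* `headFlipBody_sqrt2_uniform` — the UNIFORM form with `n₀ = 10`: every `n ≥ 10`, `n ≤ m`, `(m+13)² ≤ 2n²`;
* `headFlip_of_sq_lt_two` — `ValuativeGCT.HeadFlip` BY NAME from any such slope with `b < a` (the route item is
  already closed by `HeadFlip.HeadFlip_proof` at slope `6/5`; an unconditional instance at `7/5` would restate it).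

Beyond `√2·n` no total count in any number of rows flips (`(k-2)m² + 2` against `k n² - 2n + k + 1`), so the
residual of the crux above this head is isotypic (the tail, `TailFlip ⇔ ValuativeFlip`).
[this crux: STRATEGY-CENSUS.md §Strengthen 3, Lines/four_row_count.lean; BLMW 2011 §5.2; Mulmuley–Sohoni 2001 §4; new]
-/

set_option linter.dupNamespace false
set_option maxHeartbeats 800000

namespace Summit.ValiantsHypothesis.ValiantsHypothesis.Theorems.ValuativeFlip

open MvPolynomial
open scoped BigOperators Matrix
open Literature.NumberTheory.DiophantineGeometry
open Literature.Computability.AlgebraicComplexity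

noncomputable section

/-- **The linear head of the window at every slope `a/b < √2`** (body form): for `0 < b` and
`a² < 2b²`, for all large `n` and every `n ≤ m` with `b·m ≤ a·n` the body of `ValuativeGCT.ValuativeFlip`
holds at `(n, m)` — the four-row count at its limiting slope, from the sharp cyclic tridiagonal pencil
certificate `cyc_pencilCertificate_of_sq_lt` and the landed head machinery
`headFlipBody_of_pencilCertificate_slope`. [this crux; new] -/
theorem headFlipBody_of_sq_lt_two (a b : ℕ) (hb : 0 < b) (hab : a ^ 2 < 2 * b ^ 2) :
    ∃ n₀ : ℕ, ∀ n ≥ n₀, ∀ (m : ℕ) [NeZero m], n ≤ m → b * m ≤ a * n →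
      ∃ (U : Submodule ℂ (MatIdx m → ℂ)) (r δ : ℕ) (lam : Nat.Partition (m * δ)), (∀ u ∈ U, (Matrix.of fun a b : Fin m => u (toLex (a, b))).rank ≤ r) ∧ lam.parts.card ≤ m * m ∧ (let χ : Weight (MatIdx m) := (Weight.dualOfPartition (m * m) lam).toMatIdx; let T : Submodule ℂ (MvPolynomial (MatIdx m × MatIdx m) ℂ) := MvPolynomial.homogeneousSubmodule (MatIdx m × MatIdx m) ℂ (m * δ) ⊓ ((MvPolynomial.vanishingIdeal ℂ {p : MatIdx m × MatIdx m → ℂ | ∀ j : MatIdx m, (fun i => p (j, i)) ∈ U}) ^ (δ * (m - r))).restrictScalars ℂ ⊓ (⨅ (M : Matrix (MatIdx m) (MatIdx m) ℂ) (_ : linSubst (MatIdx m) ℂ M (detFormLex ℂ m) = detFormLex ℂ m), LinearMap.ker ((MvPolynomial.aeval (R := ℂ) fun p : MatIdx m × MatIdx m => ∑ l : MatIdx m, M l p.2 • MvPolynomial.X (p.1, l)).toLinearMap - LinearMap.id (R := ℂ) (M := MvPolynomial (MatIdx m × MatIdx m) ℂ))) ⊓ (⨅ (g : Matrix.GeneralLinearGroup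 (MatIdx m) ℂ) (_ : IsUpperTriangular g), LinearMap.ker ((MvPolynomial.aeval (R := ℂ) fun p : MatIdx m × MatIdx m => ∑ l : MatIdx m, ((g⁻¹ : Matrix.GeneralLinearGroup (MatIdx m) ℂ) : Matrix (MatIdx m) (MatIdx m) ℂ) p.1 l • MvPolynomial.X (l, p.2)).toLinearMap - weightChar χ g • LinearMap.id (R := ℂ) (M := MvPolynomial (MatIdx m × MatIdx m) ℂ))); Module.finrank ℂ ↥T < orbitMultiplicity ℂ (paddedPerFormLex ℂ n m) m χ) :=
  headFlipBody_of_pencilCertificate_slope a b hb (cyc_pencilCertificate_of_sq_lt a b hb hab)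

/-- **The head at slope `7/5`**: for all large `n` and every `n ≤ m ≤ (7/5)·n` the body of
`ValuativeGCT.ValuativeFlip` holds at `(n, m)` (`7² = 49 < 50 = 2·5²`). [this crux; new] -/
theorem headFlipBody_seven_fifths :
    ∃ n₀ : ℕ, ∀ n ≥ n₀, ∀ (m : ℕ) [NeZero m], n ≤ m → 5 * m ≤ 7 * n →
      ∃ (U : Submodule ℂ (MatIdx m → ℂ)) (r δ : ℕ) (lam : Nat.Partition (m * δ)), (∀ u ∈ U, (Matrix.of fun a b : Fin m => u (toLex (a, b))).rank ≤ r) ∧ lam.parts.card ≤ m * m ∧ (let χ : Weight (MatIdx m) := (Weight.dualOfPartition (m * m) lam).toMatIdx; let T : Submodule ℂ (MvPolynomial (MatIdx m × MatIdx m) ℂ) := MvPolynomial.homogeneousSubmodule (MatIdx m × MatIdx m) ℂ (m * δ) ⊓ ((MvPolynomial.vanishingIdeal ℂ {p : MatIdx m × MatIdx m → ℂ | ∀ j : MatIdx m, (fun i => p (j, i)) ∈ U}) ^ (δ * (m - r))).restrictScalars ℂ ⊓ (⨅ (M : Matrix (MatIdx m) (MatIdx m) ℂ) (_ : linSubst (MatIdx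 m) ℂ M (detFormLex ℂ m) = detFormLex ℂ m), LinearMap.ker ((MvPolynomial.aeval (R := ℂ) fun p : MatIdx m × MatIdx m => ∑ l : MatIdx m, M l p.2 • MvPolynomial.X (p.1, l)).toLinearMap - LinearMap.id (R := ℂ) (M := MvPolynomial (MatIdx m × MatIdx m) ℂ))) ⊓ (⨅ (g : Matrix.GeneralLinearGroup (MatIdx m) ℂ) (_ : IsUpperTriangular g), LinearMap.ker ((MvPolynomial.aeval (R := ℂ) fun p : MatIdx m × MatIdx m => ∑ l : MatIdx m, ((g⁻¹ : Matrix.GeneralLinearGroup (MatIdx m) ℂ) : Matrix (MatIdx m) (MatIdx m) ℂ) p.1 l • MvPolynomial.X (l, p.2)).toLinearMap - weightChar χ g • LinearMap.id (R := ℂ) (M := MvPolynomial (MatIdx m × MatIdx m) ℂ))); Module.finrank ℂ ↥T < orbitMultiplicity ℂ (paddedPerFormLex ℂ n m) m χ) :=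
  headFlipBody_of_sq_lt_two 7 5 (by norm_num) (by norm_num)

/-- **The head up to `√2·n`, UNIFORMLY** (pointwise, `n₀ = 10`): for every `n ≥ 10` and every `m` with
`n ≤ m` and `(m + 13)² ≤ 2n²` the body of `ValuativeGCT.ValuativeFlip` holds at `(n, m)` (`U = ⊥`, `r = 0`,
a `≤ 4`-row shape); e.g. the position `m = n + 1` for every `n ≥ 34`, and `m ≤ 1.3·n` for every `n ≥ 150`.
Arithmetic: `2m² + m + 2 = 2(m+13)² - 51m - 336 ≤ 4n² - 48n + 140 ≤ ((n-6)/2)(8n-40)`,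
the pointwise rank of the cyclic tridiagonal family (`cyc_family_finrank_ge`), then
`headFlipBody_of_pencilCert_at`. [this crux; new] -/
theorem headFlipBody_sqrt2_uniform (n : ℕ) (hn : 10 ≤ n) (m : ℕ) [NeZero m] (hnm : n ≤ m)
    (hm : (m + 13) ^ 2 ≤ 2 * n ^ 2) :
    ∃ (U : Submodule ℂ (MatIdx m → ℂ)) (r δ : ℕ) (lam : Nat.Partition (m * δ)), (∀ u ∈ U, (Matrix.of fun a b : Fin m => u (toLex (a, b))).rank ≤ r) ∧ lam.parts.card ≤ m * m ∧ (let χ : Weight (MatIdx m) := (Weight.dualOfPartition (m * m) lam).toMatIdx; let T : Submodule ℂ (MvPolynomial (MatIdx m × MatIdx m) ℂ) := MvPolynomial.homogeneousSubmodule (MatIdx m × MatIdx m) ℂ (m * δ) ⊓ ((MvPolynomial.vanishingIdeal ℂ {p : MatIdx m × MatIdx m → ℂ | ∀ j : MatIdx m, (fun i => p (j, i)) ∈ U}) ^ (δ * (m - r))).restrictScalars ℂ ⊓ (⨅ (M : Matrix (MatIdx m) (MatIdx m) ℂ) (_ : linSubst (MatIdx m) ℂ M (detFormLex ℂ m) =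 detFormLex ℂ m), LinearMap.ker ((MvPolynomial.aeval (R := ℂ) fun p : MatIdx m × MatIdx m => ∑ l : MatIdx m, M l p.2 • MvPolynomial.X (p.1, l)).toLinearMap - LinearMap.id (R := ℂ) (M := MvPolynomial (MatIdx m × MatIdx m) ℂ))) ⊓ (⨅ (g : Matrix.GeneralLinearGroup (MatIdx m) ℂ) (_ : IsUpperTriangular g), LinearMap.ker ((MvPolynomial.aeval (R := ℂ) fun p : MatIdx m × MatIdx m => ∑ l : MatIdx m, ((g⁻¹ : Matrix.GeneralLinearGroup (MatIdx m) ℂ) : Matrix (MatIdx m) (MatIdx m) ℂ) p.1 l • MvPolynomial.X (l, p.2)).toLinearMap - weightChar χ g • LinearMap.id (R := ℂ) (M := MvPolynomial (MatIdx m × MatIdx m) ℂ))); Module.finrank ℂ ↥T < orbitMultiplicity ℂ (paddedPerFormLex ℂ n m) m χ) := by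
  obtain ⟨k, rfl⟩ : ∃ k, n = k + 1 := ⟨n - 1, by omega⟩
  refine headFlipBody_of_pencilCert_at (k + 1) m hnm (by omega)
    (cycP (fun r : ZMod (k + 1) => ((r.val : ℕ) : ℂ)))
    (![((0 : ZMod (k + 1)), (1 : ZMod (k + 1))), (1, 2), (0, 0), (1, 1)] :
      Fin 4 → ZMod (k + 1) × ZMod (k + 1)) (cyc_isUnit k (by omega))
    (le_trans ?_ (cyc_family_finrank_ge k (by omega)))
  -- `2m² + m + 2 ≤ ((k+1-6)/2)(8(k+1)-40)`
  obtain ⟨p, rfl⟩ : ∃ p, k = p + 9 := ⟨k - 9, by omega⟩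
  set s := (p + 9 + 1 - 6) / 2 with hs
  have hS : p + 3 ≤ 2 * s := by
    have h1 := Nat.div_add_mod (p + 9 + 1 - 6) 2
    have h2 := Nat.mod_lt (p + 9 + 1 - 6) (show 0 < 2 by norm_num)
    omega
  have hB : 8 * (p + 9 + 1) - 40 = 2 * (4 * p + 20) := by omega
  rw [hB]
  have hR : (p + 3) * (4 * p + 20) ≤ s * (2 * (4 * p + 20)) := by nlinarith
  refine le_trans ?_ hR
  have hm' : (m + 13) ^ 2 ≤ 2 * (p + 10) ^ 2 := by
    simpa [show p + 9 + 1 = p + 10 by ring] using hm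
  have hnm' : p + 10 ≤ m := by omega
  nlinarith

/-- **`HeadFlip` from any slope below `√2`**: for `0 < b < a` with `a² < 2b²` the route decl
`ValuativeGCT.HeadFlip` (stmt-ValiantsHypothesis-15535) BY NAME, with that slope as its witness.
[this crux; new] -/
theorem headFlip_of_sq_lt_two (a b : ℕ) (hb : 0 < b) (hba : b < a) (hab : a ^ 2 < 2 * b ^ 2) :
    Summit.ValiantsHypothesis.ValiantsHypothesis.Theses.ValuativeGCT.HeadFlip :=
  headFlip_of_pencilCertificate_slope a b hb hba (cyc_pencilCertificate_of_sq_lt a b hb hab)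

end

end Summit.ValiantsHypothesis.ValiantsHypothesis.Theorems.ValuativeFlip
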